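import Literature.AlgebraicTopology.SingularHomology.LocalHomologyMayerVietorisCriteria
import Literature.AlgebraicTopology.SingularHomology.LocalHomologyOfSetTransfer
import Literature.AlgebraicTopology.SingularHomology.EulerCharacteristicTriple
import Mathlib.LinearAlgebra.FiniteDimensional.Lemmas
import Mathlib.RingTheory.Finiteness.Finsupp

/-!
# Aux file 1 of stub `stub_friendsH2` (line `mk_friends`, crux `DcrGap`): rank bookkeeping
(item stmt-SmoothPoincare4-16128, route route-SmoothPoincare4-DottedCircleRasmussen)

Two pieces of linear algebra over `ℚ` behind the `H₂`-leaf of the friends lemma (the `k ≥ 1`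
analogue of the tree's PROVED `Knot.isZero_singularHomologyZ_two_of_isSliceDiscIn_of_range_eq_holds`,
Manolescu–Piccirillo 2023, §3.2, proof of Lemma 3.3: "It is routine to confirm that `X` has the
homology type of `W`"), written so that the model handlebody `D_k` enters ONLY through the two
numbers `p_q = dim_ℚ H_q(· | D_k; ℚ)`, `q = 2, 3`:

* `FriendsH2.mvCount` — for closed `A`, `B` in a space `Y` with `H_q(Y | B) = 0` (`q = 2, 3`),
  `H₂(Y | A ∩ B) = 0`, `dim H₃(Y | A ∩ B) = 1`, `H₄(Y | A) → H₄(Y | A ∩ B)` onto and `H_q(Y | A)`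
  finite-dimensional (`q = 2, 3`), the relative Mayer–Vietoris sequence (Hatcher §2.2 p. 152, the
  tree's `clocalHomology.mv_exact₁/₂/₃`) gives finite-dimensionality of `H_q(Y | A ∪ B)` (`q = 2, 3`)
  and the rank identity `dim H₃(Y | A ∪ B) - dim H₂(Y | A ∪ B) = dim H₃(Y | A) - 1 - dim H₂(Y | A)`
  (an Euler-characteristic count: the unknown rank of `H₃(Y | A) → H₃(Y | A ∩ B)` cancels);
* `FriendsH2.lesCount` — for `S ⊆ Y` with `H₃(Y) = H₁(Y) = 0` and finite-dimensional
  `H₂(S), H₁(S), H₃(Y, S), H₂(Y, S)`, the long exact sequence of the pair (Hatcher Thm. 2.16) gives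
  `dim H₂(Y) = dim H₂(S) - dim H₁(S) - dim H₃(Y, S) + dim H₂(Y, S)`.

Pure homological algebra (`Function.Exact`, rank–nullity); no definitions, no named facts, no `sorry`.

## References

* A. Hatcher, *Algebraic Topology*, CUP 2002, §2.1 Thm. 2.16, §2.2 p. 152. [HatcherAT2002]
* C. Manolescu, L. Piccirillo, J. Lond. Math. Soc. 108 (2023), §3.2, proof of Lemma 3.3.
  [ManolescuPiccirillo2023]
-/

-- the prescribed namespace `Summit.<P>.<Sub>.…` duplicates `SmoothPoincare4` (P = Sub)
set_option linter.dupNamespace false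
set_option linter.style.longLine false
-- as in `LocalHomologyMayerVietoris`: chains of the concrete complex are `Finsupp`s up to unfolding
set_option backward.isDefEq.respectTransparency false

noncomputable section

open CategoryTheory Limits Set Function
open Literature.AlgebraicTopology.SingularHomology

universe u v w

namespace Summit.SmoothPoincare4.SmoothPoincare4.Theorems.DcrGap.MkFriends

namespace FriendsH2

/-! ## Linear algebra: the rank count along a seven-term exact sequence -/

section Algebra

variable {K : Type*} [Field K]
  {P₄ Q₄ U₃ P₃ Q₃ U₂ P₂ Q₂ : Type*}
  [AddCommGroup P₄] [Module K P₄] [AddCommGroup Q₄] [Module K Q₄]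
  [AddCommGroup U₃] [Module K U₃] [AddCommGroup P₃] [Module K P₃]
  [AddCommGroup Q₃] [Module K Q₃] [AddCommGroup U₂] [Module K U₂]
  [AddCommGroup P₂] [Module K P₂] [AddCommGroup Q₂] [Module K Q₂]

/-- **Rank count along an exact sequence `P₄ → Q₄ → U₃ → P₃ → Q₃ → U₂ → P₂ → Q₂`** of vector
spaces with `P₄ → Q₄` onto, `Q₂ = 0` and `P₃, Q₃, P₂` finite-dimensional: then `U₃`, `U₂` are
finite-dimensional and `dim U₃ - dim U₂ = dim P₃ - dim Q₃ - dim P₂` (rank–nullity; the rank of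
`P₃ → Q₃` cancels). [folklore] -/
theorem finrank_count_of_exact (d₄ : P₄ →ₗ[K] Q₄) (δ₃ : Q₄ →ₗ[K] U₃) (r₃ : U₃ →ₗ[K] P₃)
    (d₃ : P₃ →ₗ[K] Q₃) (δ₂ : Q₃ →ₗ[K] U₂) (r₂ : U₂ →ₗ[K] P₂) (d₂ : P₂ →ₗ[K] Q₂)
    (e₄ : Function.Exact d₄ δ₃) (e₃ : Function.Exact δ₃ r₃) (e₃' : Function.Exact r₃ d₃)
    (e₂ : Function.Exact d₃ δ₂) (e₂' : Function.Exact δ₂ r₂) (e₁ : Function.Exact r₂ d₂)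
    (hd₄ : Surjective d₄) [Subsingleton Q₂]
    [FiniteDimensional K P₃] [FiniteDimensional K Q₃] [FiniteDimensional K P₂] :
    FiniteDimensional K U₃ ∧ FiniteDimensional K U₂ ∧
      (Module.finrank K U₃ : ℤ) - Module.finrank K U₂ =
        Module.finrank K P₃ - Module.finrank K Q₃ - Module.finrank K P₂ := by
  -- `δ₃ = 0`, so `r₃` is injective
  have hδ₃ : δ₃ = 0 := (LinearMap.surjective_iff_eq_zero_of_exact e₄).1 hd₄
  have hr₃ : Injective r₃ := (LinearMap.injective_iff_eq_zero_of_exact e₃).2 hδ₃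
  haveI hU₃ : FiniteDimensional K U₃ := Module.Finite.of_injective r₃ hr₃
  -- `d₂ = 0`, so `r₂` is onto
  have hd₂ : d₂ = 0 := Subsingleton.elim _ _
  have hr₂ : Surjective r₂ := (LinearMap.surjective_iff_eq_zero_of_exact e₁).2 hd₂
  -- `U₂` is an extension of `P₂` by the image of `Q₃`
  haveI hU₂ : FiniteDimensional K U₂ := by
    have htop : (⊤ : Submodule K U₂).FG := by
      refine Submodule.fg_of_fg_map_of_fg_inf_ker r₂ ?_ ?_
      · exact (Submodule.fg_iff_finiteDimensional _).2 inferInstance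
      · rw [top_inf_eq, e₂'.linearMap_ker_eq, LinearMap.range_eq_map]
        exact (Module.Finite.fg_top (R := K) (M := Q₃)).map δ₂
    exact ⟨htop⟩
  refine ⟨hU₃, hU₂, ?_⟩
  -- rank–nullity
  have h₁ := r₃.finrank_range_add_finrank_ker
  have h₂ := d₃.finrank_range_add_finrank_ker
  have h₃ := δ₂.finrank_range_add_finrank_ker
  have h₄ := r₂.finrank_range_add_finrank_ker
  have hk₃ : Module.finrank K (LinearMap.ker r₃) = 0 := by
    rw [LinearMap.ker_eq_bot.2 hr₃, finrank_bot]
  have hk₃' : Module.finrank K (LinearMap.ker d₃) = Module.finrank K (LinearMap.range r₃) :=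
    congrArg (fun S : Submodule K P₃ => Module.finrank K S) e₃'.linearMap_ker_eq
  have hk₂ : Module.finrank K (LinearMap.ker δ₂) = Module.finrank K (LinearMap.range d₃) :=
    congrArg (fun S : Submodule K Q₃ => Module.finrank K S) e₂.linearMap_ker_eq
  have hk₂' : Module.finrank K (LinearMap.ker r₂) = Module.finrank K (LinearMap.range δ₂) :=
    congrArg (fun S : Submodule K U₂ => Module.finrank K S) e₂'.linearMap_ker_eq
  have hr₂' : Module.finrank K (LinearMap.range r₂) = Module.finrank K P₂ := by
    rw [LinearMap.range_eq_top.2 hr₂, finrank_top]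
  omega

end Algebra

/-! ## Linear algebra in `ModuleCat`: the rank count along the sequence of a pair -/

section Pair

variable {R : Type v} [Field R]

/-- **Rank count along a six-term exact sequence in `ModuleCat`**
`L₃ → W₂ → X₂ → L₂ → W₁` with `H → L₃` from a zero object and `W₁ → Z` into a zero object exact at
the ends: `dim X₂ = dim W₂ - dim L₃ + dim L₂ - dim W₁`, all terms finite-dimensional.
[folklore] -/
theorem finrank_eq_of_exact₆ {Z₃ L₃ W₂ X₂ L₂ W₁ Z₁ : ModuleCat.{w} R}
    (a : Z₃ ⟶ L₃) (b : L₃ ⟶ W₂) (c : W₂ ⟶ X₂) (d : X₂ ⟶ L₂) (e : L₂ ⟶ W₁) (f : W₁ ⟶ Z₁)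
    (wab : a ≫ b = 0) (wbc : b ≫ c = 0) (wcd : c ≫ d = 0) (wde : d ≫ e = 0) (wef : e ≫ f = 0)
    (hab : (ShortComplex.mk a b wab).Exact) (hbc : (ShortComplex.mk b c wbc).Exact)
    (hcd : (ShortComplex.mk c d wcd).Exact) (hde : (ShortComplex.mk d e wde).Exact)
    (hef : (ShortComplex.mk e f wef).Exact)
    (hZ₃ : IsZero Z₃) (hZ₁ : IsZero Z₁)
    [Module.Finite R L₃] [Module.Finite R W₂] [Module.Finite R L₂] [Module.Finite R W₁] :
    Module.Finite R X₂ ∧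
      (Module.finrank R X₂ : ℤ) =
        Module.finrank R W₂ - Module.finrank R L₃ + Module.finrank R L₂ - Module.finrank R W₁ := by
  haveI : Module.Finite R X₂ := hcd.moduleCat_finite_X₂
  refine ⟨this, ?_⟩
  have h₁ := hab.finrank_X₂_eq
  have h₂ := hbc.finrank_X₂_eq
  have h₃ := hcd.finrank_X₂_eq
  have h₄ := hde.finrank_X₂_eq
  have h₅ := hef.finrank_X₂_eq
  simp only at h₁ h₂ h₃ h₄ h₅
  have ha : Module.finrank R (LinearMap.range a.hom) = 0 := finrank_range_of_isZero_source a hZ₃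
  have hf : Module.finrank R (LinearMap.range f.hom) = 0 := finrank_range_of_isZero_target f hZ₁
  omega


/-- **Rank count along the long exact sequence of a pair `(Y, S)`** (Hatcher 2002, Thm. 2.16):
if `H₃(Y; ℚ) = H₁(Y; ℚ) = 0` and `H₃(Y, S)`, `H₂(Y, S)`, `H₂(S)`, `H₁(S)` are finite-dimensional,
then so is `H₂(Y)` and `dim H₂(Y) = dim H₂(S) - dim H₃(Y, S) + dim H₂(Y, S) - dim H₁(S)`.
[cite: HatcherAT2002, Thm. 2.16] -/
theorem lesCount {Y : Type u} [TopologicalSpace Y] (S : Set Y)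
    (h3 : IsZero (singularHomology ℚ ℚ Y 3)) (h1 : IsZero (singularHomology ℚ ℚ Y 1))
    [Module.Finite ℚ (relativeSingularHomology ℚ ℚ Y S 3)]
    [Module.Finite ℚ (relativeSingularHomology ℚ ℚ Y S 2)]
    [Module.Finite ℚ (singularHomology ℚ ℚ S 2)] [Module.Finite ℚ (singularHomology ℚ ℚ S 1)] :
    Module.Finite ℚ (singularHomology ℚ ℚ Y 2) ∧
      (Module.finrank ℚ (singularHomology ℚ ℚ Y 2) : ℤ) =
        Module.finrank ℚ (singularHomology ℚ ℚ S 2) -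
          Module.finrank ℚ (relativeSingularHomology ℚ ℚ Y S 3) +
          Module.finrank ℚ (relativeSingularHomology ℚ ℚ Y S 2) -
          Module.finrank ℚ (singularHomology ℚ ℚ S 1) :=
  finrank_eq_of_exact₆ (relativeSingularHomology.ofAbsolute ℚ ℚ Y S 3)
    (relativeSingularHomology.δ ℚ ℚ Y S 2)
    (singularHomology.map ℚ ℚ (⟨Subtype.val, continuous_subtype_val⟩ : C(S, Y)) 2)
    (relativeSingularHomology.ofAbsolute ℚ ℚ Y S 2) (relativeSingularHomology.δ ℚ ℚ Y S 1)
    (singularHomology.map ℚ ℚ (⟨Subtype.val, continuous_subtype_val⟩ : C(S, Y)) 1)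
    (relativeSingularHomology.ofAbsolute_comp_δ ℚ ℚ S 2) (relativeSingularHomology.δ_comp_map ℚ ℚ S 2)
    (relativeSingularHomology.map_comp_ofAbsolute ℚ ℚ S 2)
    (relativeSingularHomology.ofAbsolute_comp_δ ℚ ℚ S 1) (relativeSingularHomology.δ_comp_map ℚ ℚ S 1)
    (relativeSingularHomology.exact_ofAbsolute_δ ℚ ℚ S 2) (relativeSingularHomology.exact_δ_map ℚ ℚ S 2)
    (relativeSingularHomology.exact_map_ofAbsolute ℚ ℚ S 2)
    (relativeSingularHomology.exact_ofAbsolute_δ ℚ ℚ S 1) (relativeSingularHomology.exact_δ_map ℚ ℚ S 1)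
    h3 h1

end Pair

/-! ## The relative Mayer–Vietoris rank count -/

section MV

variable {Y : Type u} [TopologicalSpace Y] {A B : Set Y}

/-- Finite-dimensionality passes through the comparison with the concrete model. [folklore] -/
theorem finite_clocalHomology_iff (K : Set Y) (i : ℕ) :
    Module.Finite ℚ (clocalHomology ℚ ℚ Y K i) ↔ Module.Finite ℚ (localHomologyOfSet ℚ ℚ Y K i) :=
  ⟨fun _ => Module.Finite.equiv (localHomologyOfSet.cmpIso ℚ ℚ Y K i).toLinearEquiv.symm,
    fun _ => Module.Finite.equiv (localHomologyOfSet.cmpIso ℚ ℚ Y K i).toLinearEquiv⟩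

/-- Ranks agree across the comparison with the concrete model. [folklore] -/
theorem finrank_clocalHomology_eq (K : Set Y) (i : ℕ) :
    Module.finrank ℚ (clocalHomology ℚ ℚ Y K i) = Module.finrank ℚ (localHomologyOfSet ℚ ℚ Y K i) :=
  (localHomologyOfSet.cmpIso ℚ ℚ Y K i).toLinearEquiv.finrank_eq.symm

/-- **The Mayer–Vietoris rank count for `H_*(Y | A ∪ B; ℚ)`** (Hatcher 2002, §2.2 p. 152, the
relative Mayer–Vietoris sequence
`H₄(Y|A) ⊕ H₄(Y|B) → H₄(Y|A ∩ B) → H₃(Y|A ∪ B) → H₃(Y|A) ⊕ H₃(Y|B) → H₃(Y|A ∩ B) → H₂(Y|A ∪ B) → H₂(Y|A) ⊕ H₂(Y|B) → H₂(Y|A ∩ B)`).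
For closed `A`, `B`, `Γ = A ∩ B`, with `H₂(Y | B) = H₃(Y | B) = 0`, `H₂(Y | Γ) = 0`, `dim H₃(Y | Γ) = 1`,
`H₄(Y | A) → H₄(Y | Γ)` onto and `H₂(Y | A)`, `H₃(Y | A)` finite-dimensional:
`H₂(Y | A ∪ B)`, `H₃(Y | A ∪ B)` are finite-dimensional and
`dim H₃(Y | A ∪ B) - dim H₂(Y | A ∪ B) = dim H₃(Y | A) - 1 - dim H₂(Y | A)`.
[cite: HatcherAT2002, §2.2 p. 152] -/
theorem mvCount (hA : IsClosed A) (hB : IsClosed B) {Γ : Set Y} (hΓ : A ∩ B = Γ) (hΓA : Γ ⊆ A)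
    (hB2 : IsZero (localHomologyOfSet ℚ ℚ Y B 2)) (hB3 : IsZero (localHomologyOfSet ℚ ℚ Y B 3))
    (hΓ2 : IsZero (localHomologyOfSet ℚ ℚ Y Γ 2))
    [Module.Finite ℚ (localHomologyOfSet ℚ ℚ Y Γ 3)]
    (hΓ3 : Module.finrank ℚ (localHomologyOfSet ℚ ℚ Y Γ 3) = 1)
    (h4 : Surjective (restrictLocal ℚ ℚ hΓA 4))
    [Module.Finite ℚ (localHomologyOfSet ℚ ℚ Y A 2)] [Module.Finite ℚ (localHomologyOfSet ℚ ℚ Y A 3)] :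
    Module.Finite ℚ (localHomologyOfSet ℚ ℚ Y (A ∪ B) 3) ∧
    Module.Finite ℚ (localHomologyOfSet ℚ ℚ Y (A ∪ B) 2) ∧
    (Module.finrank ℚ (localHomologyOfSet ℚ ℚ Y (A ∪ B) 3) : ℤ) -
        Module.finrank ℚ (localHomologyOfSet ℚ ℚ Y (A ∪ B) 2) =
      Module.finrank ℚ (localHomologyOfSet ℚ ℚ Y A 3) - 1 -
        Module.finrank ℚ (localHomologyOfSet ℚ ℚ Y A 2) := by
  subst hΓ
  -- finiteness and vanishing in the concrete model
  have hB2' := localHomologyOfSet.isZero_clocalHomology_of_isZero ℚ ℚ hB2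
  have hB3' := localHomologyOfSet.isZero_clocalHomology_of_isZero ℚ ℚ hB3
  have hΓ2' := localHomologyOfSet.isZero_clocalHomology_of_isZero ℚ ℚ hΓ2
  haveI : Subsingleton (clocalHomology ℚ ℚ Y (A ∩ B) 2) := ModuleCat.subsingleton_of_isZero hΓ2'
  haveI : Module.Finite ℚ (clocalHomology ℚ ℚ Y A 2) := (finite_clocalHomology_iff A 2).2 inferInstance
  haveI : Module.Finite ℚ (clocalHomology ℚ ℚ Y A 3) := (finite_clocalHomology_iff A 3).2 inferInstance
  haveI : Module.Finite ℚ (clocalHomology ℚ ℚ Y (A ∩ B) 3) :=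
    (finite_clocalHomology_iff (A ∩ B) 3).2 inferInstance
  haveI : Module.Finite ℚ (clocalHomology ℚ ℚ Y B 2) := finite_of_isZero hB2'
  haveI : Module.Finite ℚ (clocalHomology ℚ ℚ Y B 3) := finite_of_isZero hB3'
  -- `H₄(Y|A) ⊕ H₄(Y|B) → H₄(Y|A ∩ B)` is onto
  have hd₄ : Surjective (clocalHomology.mvDiff ℚ ℚ A B 4) := by
    intro t
    obtain ⟨t', rfl⟩ := (localHomologyOfSet.cmpIso ℚ ℚ Y (A ∩ B) 4).toLinearEquiv.surjective t
    obtain ⟨β, rfl⟩ := h4 t'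
    refine ⟨((localHomologyOfSet.cmpIso ℚ ℚ Y A 4).hom β, 0), ?_⟩
    rw [clocalHomology.mvDiff_apply, map_zero, sub_zero, localHomologyOfSet.res_cmpIso_hom_apply]
    rfl
  obtain ⟨hU₃, hU₂, hcount⟩ := finrank_count_of_exact
    (clocalHomology.mvDiff ℚ ℚ A B 4) (clocalHomology.mvδ ℚ ℚ hA hB 3)
    (clocalHomology.mvRes ℚ ℚ A B 3) (clocalHomology.mvDiff ℚ ℚ A B 3)
    (clocalHomology.mvδ ℚ ℚ hA hB 2) (clocalHomology.mvRes ℚ ℚ A B 2)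
    (clocalHomology.mvDiff ℚ ℚ A B 2)
    (clocalHomology.mv_exact₃ ℚ ℚ hA hB 3) (clocalHomology.mv_exact₁ ℚ ℚ hA hB 3)
    (clocalHomology.mv_exact₂ ℚ ℚ hA hB 3) (clocalHomology.mv_exact₃ ℚ ℚ hA hB 2)
    (clocalHomology.mv_exact₁ ℚ ℚ hA hB 2) (clocalHomology.mv_exact₂ ℚ ℚ hA hB 2) hd₄
  refine ⟨(finite_clocalHomology_iff (A ∪ B) 3).1 hU₃, (finite_clocalHomology_iff (A ∪ B) 2).1 hU₂, ?_⟩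
  rw [Module.finrank_prod, Module.finrank_prod, finrank_eq_zero_of_isZero hB3',
    finrank_eq_zero_of_isZero hB2', finrank_clocalHomology_eq, finrank_clocalHomology_eq,
    finrank_clocalHomology_eq, finrank_clocalHomology_eq, finrank_clocalHomology_eq, hΓ3] at hcount
  push_cast at hcount
  linarith

end MV

end FriendsH2

/-- **Registered helper (aux 1 of `stub_friendsH2`)**: the rank count along the long exact sequence of a pair `(Y, S)` with `H₃(Y; ℚ) = H₁(Y; ℚ) = 0` (`FriendsH2.lesCount`, Hatcher Thm. 2.16). [cite: HatcherAT2002, Thm. 2.16] -/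
theorem helper_friendsH2_lesCount : ∀ (Y : Type) [TopologicalSpace Y] (S : Set Y), CategoryTheory.Limits.IsZero (Literature.AlgebraicTopology.SingularHomology.singularHomology ℚ ℚ Y 3) → CategoryTheory.Limits.IsZero (Literature.AlgebraicTopology.SingularHomology.singularHomology ℚ ℚ Y 1) → Module.Finite ℚ (Literature.AlgebraicTopology.SingularHomology.relativeSingularHomology ℚ ℚ Y S 3) → Module.Finite ℚ (Literature.AlgebraicTopology.SingularHomology.relativeSingularHomology ℚ ℚ Y S 2) → Module.Finite ℚ (Literature.AlgebraicTopology.SingularHomology.singularHomology ℚ ℚ S 2) → Module.Finite ℚ (Literature.AlgebraicTopology.SingularHomology.singularHomology ℚ ℚ S 1) → Module.Finite ℚ (Literature.AlgebraicTopology.SingularHomology.singularHomology ℚ ℚ Y 2) ∧ (Module.finrank ℚ (Literature.AlgebraicTopology.SingularHomology.singularHomology ℚ ℚ Y 2) : ℤ) = Module.finrank ℚ (Literature.AlgebraicTopology.SingularHomology.singularHomology ℚ ℚ S 2) - Module.finrank ℚ (Literature.AlgebraicTopology.SingularHomology.relativeSingularHomology ℚ ℚ Y S 3) + Module.finrank ℚ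 (Literature.AlgebraicTopology.SingularHomology.relativeSingularHomology ℚ ℚ Y S 2) - Module.finrank ℚ (Literature.AlgebraicTopology.SingularHomology.singularHomology ℚ ℚ S 1) := by
  intro Y _ S h3 h1 i₁ i₂ i₃ i₄
  haveI := i₁; haveI := i₂; haveI := i₃; haveI := i₄
  exact FriendsH2.lesCount S h3 h1

end Summit.SmoothPoincare4.SmoothPoincare4.Theorems.DcrGap.MkFriends

end
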